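import Summits.Ventures.PercRepro.C026CutVertex
import Summits.Ventures.PercRepro.C026DCSub

/-!
# mine-3's Theorem B (B2): the C-026 slack over a cut vertex separating `c` from `a, b` (p5, gen 15)

mine-3 (`proofs/MINE3-BLOCKS.md` §1 (B2), §2): if `v ∉ {a, b, c}` is a cut vertex with `c` on one side and
`a, b` on the other, then `Δ_CF(G) = #{v ~ c}(G₂) · Δ_CF(G₁; a, b, v)` — the events factor through the cut
vertex (C026CutVertex), the `c`-side contributes the number of its configurations joining `v` to `c` (by
complement symmetry the same number for the closed events), and the `a, b`-side contributes its own slack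
with `v` as the third mark. With `v` the cut vertex of the two-colouring `side` (`IsGluing v v v side`),
`G₁ = G.part side true ∋ a, b` and `G₂ = G.part side false ∋ c`.

* `card_filter_compl_config` — complement symmetry on a cube: `#{ω : p ωᶜ} = #{ω : p ω}`;
* **`slackCF_cut`** (B2).
-/

namespace PercRepro

open Finset

namespace MultiGraph

section CutVertexB2

variable {V E : Type*} {G : MultiGraph V E}

open Classical in
/-- **Complement symmetry**: on any cube, `#{ω : p ωᶜ} = #{ω : p ω}`. -/
theorem card_filter_compl_config {E' : Type*} [Fintype E'] (p : Config E' → Prop) :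
    (univ.filter fun ω : Config E' => p ωᶜ).card = (univ.filter fun ω : Config E' => p ω).card := by
  refine Finset.card_nbij' (fun ω => ωᶜ) (fun ω => ωᶜ) ?_ ?_ ?_ ?_
  · intro ω hω
    simp only [Finset.coe_filter, Finset.mem_univ, true_and, Set.mem_setOf_eq] at hω ⊢
    exact hω
  · intro ω hω
    simp only [Finset.coe_filter, Finset.mem_univ, true_and, Set.mem_setOf_eq, compl_compl] at hω ⊢
    exact hω
  · intro ω _
    exact compl_compl ω
  · intro ω _
    exact compl_compl ω

open Classical in
/-- **THEOREM B (B2)**: for a cut vertex `v ∉ {a, b, c}` with `a, b` on side `true` and `c` on side `false`,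
`Δ_CF(G) = #{v ~ c}(G₂) · Δ_CF(G₁; a, b, v)`. -/
theorem slackCF_cut [Fintype E] {v : V} {side : E → Bool} (hg : G.IsGluing v v v side) {a b c : V}
    (ha : G.OnSide side true a) (hb : G.OnSide side true b) (hc : G.OnSide side false c)
    (hac : a ≠ c) (hbc : b ≠ c) :
    G.slackCF a b c =
      ((univ.filter fun ω₂ : Config {e // side e = false} =>
        (G.part side false).Conn ω₂ v c).card : ℤ) * (G.part side true).slackCF a b v := by
  have htf : true ≠ false := by decide
  have hft : false ≠ true := by decide
  -- the dictionary at the marks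
  have dab : ∀ ω : Config E, G.Conn ω a b ↔
      (G.part side true).Conn (sideRestrict ω side true) a b :=
    fun ω => conn_cut_iff_same hg htf (Or.inr ha) (Or.inr hb) ω
  have dac : ∀ ω : Config E, G.Conn ω a c ↔
      (G.part side true).Conn (sideRestrict ω side true) a v ∧
        (G.part side false).Conn (sideRestrict ω side false) v c :=
    fun ω => conn_cut_iff_cross hg htf (Or.inr ha) hc hac ω
  have dca : ∀ ω : Config E, G.Conn ω c a ↔
      (G.part side false).Conn (sideRestrict ω side false) c v ∧
        (G.part side true).Conn (sideRestrict ω side true) v a :=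
    fun ω => conn_cut_iff_cross hg hft (Or.inr hc) ha (Ne.symm hac) ω
  have dcb : ∀ ω : Config E, G.Conn ω c b ↔
      (G.part side false).Conn (sideRestrict ω side false) c v ∧
        (G.part side true).Conn (sideRestrict ω side true) v b :=
    fun ω => conn_cut_iff_cross hg hft (Or.inr hc) hb (Ne.symm hbc) ω
  -- the cells of `G` as product events
  have h_ac : (univ.filter fun ω : Config E => G.Conn ω c a ∧ ¬ G.Conn ω c b).card =
      (univ.filter fun ω₁ : Config {e // side e = true} =>
          (G.part side true).Conn ω₁ v a ∧ ¬ (G.part side true).Conn ω₁ v b).card *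
        (univ.filter fun ω₂ : Config {e // side e = false} =>
          (G.part side false).Conn ω₂ c v).card := by
    have e1 : (univ.filter fun ω : Config E => G.Conn ω c a ∧ ¬ G.Conn ω c b) =
        (univ.filter fun ω : Config E =>
          ((G.part side true).Conn (sideRestrict ω side true) v a ∧
            ¬ (G.part side true).Conn (sideRestrict ω side true) v b) ∧
          (G.part side false).Conn (sideRestrict ω side false) c v) :=
      Finset.filter_congr fun ω _ => by rw [dca, dcb]; tauto
    rw [e1]
    convert card_filter_cut side
      (fun ω₁ : Config {e // side e = true} =>
        (G.part side true).Conn ω₁ v a ∧ ¬ (G.part side true).Conn ω₁ v b)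
      (fun ω₂ : Config {e // side e = false} => (G.part side false).Conn ω₂ c v) using 4
  have h_bc : (univ.filter fun ω : Config E => G.Conn ω c b ∧ ¬ G.Conn ω c a).card =
      (univ.filter fun ω₁ : Config {e // side e = true} =>
          (G.part side true).Conn ω₁ v b ∧ ¬ (G.part side true).Conn ω₁ v a).card *
        (univ.filter fun ω₂ : Config {e // side e = false} =>
          (G.part side false).Conn ω₂ c v).card := by
    have e1 : (univ.filter fun ω : Config E => G.Conn ω c b ∧ ¬ G.Conn ω c a) =
        (univ.filter fun ω : Config E =>
          ((G.part side true).Conn (sideRestrict ω side true) v b ∧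
            ¬ (G.part side true).Conn (sideRestrict ω side true) v a) ∧
          (G.part side false).Conn (sideRestrict ω side false) c v) :=
      Finset.filter_congr fun ω _ => by rw [dca, dcb]; tauto
    rw [e1]
    convert card_filter_cut side
      (fun ω₁ : Config {e // side e = true} =>
        (G.part side true).Conn ω₁ v b ∧ ¬ (G.part side true).Conn ω₁ v a)
      (fun ω₂ : Config {e // side e = false} => (G.part side false).Conn ω₂ c v) using 4
  have h_ab : (univ.filter fun ω : Config E => G.Conn ω a b ∧ ¬ G.Conn ω a c).card =
      (univ.filter fun ω₁ : Config {e // side e = true} =>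
          (G.part side true).Conn ω₁ a b).card *
        (univ.filter fun ω₂ : Config {e // side e = false} =>
          ¬ (G.part side false).Conn ω₂ v c).card +
      (univ.filter fun ω₁ : Config {e // side e = true} =>
          (G.part side true).Conn ω₁ a b ∧ ¬ (G.part side true).Conn ω₁ a v).card *
        (univ.filter fun ω₂ : Config {e // side e = false} =>
          (G.part side false).Conn ω₂ v c).card := by
    rw [← Finset.card_filter_add_card_filter_not
        (fun ω : Config E => (G.part side false).Conn (sideRestrict ω side false) v c),
      Finset.filter_filter, Finset.filter_filter, add_comm]
    congr 1
    · have e1 : (univ.filter fun ω : Config E => (G.Conn ω a b ∧ ¬ G.Conn ω a c) ∧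
          ¬ (G.part side false).Conn (sideRestrict ω side false) v c) =
          (univ.filter fun ω : Config E => (G.part side true).Conn (sideRestrict ω side true) a b ∧
            ¬ (G.part side false).Conn (sideRestrict ω side false) v c) :=
        Finset.filter_congr fun ω _ => by rw [dab, dac]; tauto
      rw [e1]
      convert card_filter_cut side
        (fun ω₁ : Config {e // side e = true} => (G.part side true).Conn ω₁ a b)
        (fun ω₂ : Config {e // side e = false} => ¬ (G.part side false).Conn ω₂ v c) using 4
    · have e1 : (univ.filter fun ω : Config E => (G.Conn ω a b ∧ ¬ G.Conn ω a c) ∧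
          (G.part side false).Conn (sideRestrict ω side false) v c) =
          (univ.filter fun ω : Config E =>
            ((G.part side true).Conn (sideRestrict ω side true) a b ∧
              ¬ (G.part side true).Conn (sideRestrict ω side true) a v) ∧
            (G.part side false).Conn (sideRestrict ω side false) v c) :=
        Finset.filter_congr fun ω _ => by rw [dab, dac]; tauto
      rw [e1]
      convert card_filter_cut side
        (fun ω₁ : Config {e // side e = true} =>
          (G.part side true).Conn ω₁ a b ∧ ¬ (G.part side true).Conn ω₁ a v)
        (fun ω₂ : Config {e // side e = false} => (G.part side false).Conn ω₂ v c) using 4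
  have h_N : (univ.filter fun ω : Config E =>
      G.Conn ω a b ∧ ¬ G.Conn ωᶜ c a ∧ ¬ G.Conn ωᶜ c b).card =
      (univ.filter fun ω₁ : Config {e // side e = true} =>
          (G.part side true).Conn ω₁ a b).card *
        (univ.filter fun ω₂ : Config {e // side e = false} =>
          ¬ (G.part side false).Conn ω₂ᶜ c v).card +
      (univ.filter fun ω₁ : Config {e // side e = true} =>
          (G.part side true).Conn ω₁ a b ∧ ¬ (G.part side true).Conn ω₁ᶜ v a ∧
            ¬ (G.part side true).Conn ω₁ᶜ v b).card *
        (univ.filter fun ω₂ : Config {e // side e = false} =>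
          (G.part side false).Conn ω₂ᶜ c v).card := by
    rw [← Finset.card_filter_add_card_filter_not
        (fun ω : Config E => (G.part side false).Conn (sideRestrict ω side false)ᶜ c v),
      Finset.filter_filter, Finset.filter_filter, add_comm]
    congr 1
    · have e1 : (univ.filter fun ω : Config E =>
          (G.Conn ω a b ∧ ¬ G.Conn ωᶜ c a ∧ ¬ G.Conn ωᶜ c b) ∧
            ¬ (G.part side false).Conn (sideRestrict ω side false)ᶜ c v) =
          (univ.filter fun ω : Config E => (G.part side true).Conn (sideRestrict ω side true) a b ∧
            ¬ (G.part side false).Conn (sideRestrict ω side false)ᶜ c v) :=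
        Finset.filter_congr fun ω _ => by
          rw [dab, dca, dcb, sideRestrict_compl, sideRestrict_compl]; tauto
      rw [e1]
      convert card_filter_cut side
        (fun ω₁ : Config {e // side e = true} => (G.part side true).Conn ω₁ a b)
        (fun ω₂ : Config {e // side e = false} => ¬ (G.part side false).Conn ω₂ᶜ c v) using 4
    · have e1 : (univ.filter fun ω : Config E =>
          (G.Conn ω a b ∧ ¬ G.Conn ωᶜ c a ∧ ¬ G.Conn ωᶜ c b) ∧
            (G.part side false).Conn (sideRestrict ω side false)ᶜ c v) =
          (univ.filter fun ω : Config E =>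
            ((G.part side true).Conn (sideRestrict ω side true) a b ∧
              ¬ (G.part side true).Conn (sideRestrict ω side true)ᶜ v a ∧
                ¬ (G.part side true).Conn (sideRestrict ω side true)ᶜ v b) ∧
            (G.part side false).Conn (sideRestrict ω side false)ᶜ c v) :=
        Finset.filter_congr fun ω _ => by
          rw [dab, dca, dcb, sideRestrict_compl, sideRestrict_compl]; tauto
      rw [e1]
      convert card_filter_cut side
        (fun ω₁ : Config {e // side e = true} =>
          (G.part side true).Conn ω₁ a b ∧ ¬ (G.part side true).Conn ω₁ᶜ v a ∧
            ¬ (G.part side true).Conn ω₁ᶜ v b)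
        (fun ω₂ : Config {e // side e = false} => (G.part side false).Conn ω₂ᶜ c v) using 4
  -- complement symmetry on the `c`-side, and `c ~ v` as `v ~ c`
  have hU : (univ.filter fun ω₂ : Config {e // side e = false} =>
      (G.part side false).Conn ω₂ᶜ c v).card =
      (univ.filter fun ω₂ : Config {e // side e = false} => (G.part side false).Conn ω₂ v c).card := by
    refine Finset.card_nbij' (fun ω => ωᶜ) (fun ω => ωᶜ) ?_ ?_ ?_ ?_
    · intro ω hω
      simp only [Finset.coe_filter, Finset.mem_univ, true_and, Set.mem_setOf_eq] at hω ⊢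
      exact hω.symm
    · intro ω hω
      simp only [Finset.coe_filter, Finset.mem_univ, true_and, Set.mem_setOf_eq, compl_compl] at hω ⊢
      exact hω.symm
    · intro ω _
      exact compl_compl ω
    · intro ω _
      exact compl_compl ω
  have hT : (univ.filter fun ω₂ : Config {e // side e = false} =>
      ¬ (G.part side false).Conn ω₂ᶜ c v).card =
      (univ.filter fun ω₂ : Config {e // side e = false} =>
        ¬ (G.part side false).Conn ω₂ v c).card := by
    refine Finset.card_nbij' (fun ω => ωᶜ) (fun ω => ωᶜ) ?_ ?_ ?_ ?_
    · intro ω hω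
      simp only [Finset.coe_filter, Finset.mem_univ, true_and, Set.mem_setOf_eq] at hω ⊢
      exact fun h => hω h.symm
    · intro ω hω
      simp only [Finset.coe_filter, Finset.mem_univ, true_and, Set.mem_setOf_eq, compl_compl] at hω ⊢
      exact fun h => hω h.symm
    · intro ω _
      exact compl_compl ω
    · intro ω _
      exact compl_compl ω
  have hC : (univ.filter fun ω₂ : Config {e // side e = false} =>
      (G.part side false).Conn ω₂ c v).card =
      (univ.filter fun ω₂ : Config {e // side e = false} => (G.part side false).Conn ω₂ v c).card := by
    rw [Finset.filter_congr fun ω _ => (conn_comm (G := G.part side false) (ω := ω) (u := c) (v := v))]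
  unfold slackCF
  rw [h_ac, h_bc, h_ab, h_N, hU, hT, hC]
  push_cast
  -- the ring identity; the remaining mismatch is the (subsingleton) `Fintype` instance of the parts' cubes
  have key : ∀ (X T U Y Z₁ Z₂ N : ℤ),
      X * T + Y * U + Z₁ * U + Z₂ * U - (X * T + N * U) = U * (Y + Z₁ + Z₂ - N) :=
    fun _ _ _ _ _ _ _ => by ring
  convert key _ _ _ _ _ _ _ using 9 <;> rfl

end CutVertexB2

end MultiGraph

end PercRepro
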